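import Literature.MathematicalPhysics.QuantumLattice.HubbardInteractionMoments
import Literature.Analysis.Matrix.HadamardInequality
import Mathlib.Analysis.Normed.Group.Tannery
import HarnessLib

/-!
# The `M → ∞` limit of the normalised Grassmann partition function of the Hubbard torus is the determinant series

Topic `MathematicalPhysics/QuantumLattice`; the series level of the `M → ∞` ("Matsubara UV") bridge.  At frequency
cutoff `M` the normalised partition function `∫dμ_{C_M} e^{-V}` (`effPartitionFn`, with the zero-seed free covariance
`hubbardCovariance L M β μ 0` and the interaction `hubbardInteraction L M β U`) is a FINITE exponential series in the
moments `∫dμ_{C_M} Vⁿ` (nilpotency), and by `HubbardInteractionMoments` each moment is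
`Uⁿ Σ_{x⃗} ∫_{[0,β]ⁿ} det[−SᵀC_MS]` and converges as `M → ∞` to `Uⁿ Σ_{x⃗} ∫_{[0,β]ⁿ} det[vertexLimitEntry]`.
Hadamard's inequality bounds the `2n × 2n` determinants by `((2n)B²)ⁿ` UNIFORMLY in `M`
(`B = L⁻² Σ_{k⃗}(2 + β|ξ_{k⃗}|/3)`, `norm_vertexWickEntry_le`), so for `2e|U|L²βB² < 1` the series is dominated by a
geometric one and Tannery's theorem gives the limit of the sums (BGM 2006, (2.6)–(2.8): in finite volume the
determinant expansion is absolutely convergent for small `U`; here at fixed `(β, L)`, radius `U_*(β,L,μ)`):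

* `effPartitionFn_eq_sum_range`, `effPartitionFn_eq_tsum` — `∫dμ_C e^{-V} = Σ_n (−1)ⁿ/n! ∫dμ_C Vⁿ` for `V` without
  constant part (any finite label set);
* `norm_det_le_of_entry_le` — Hadamard: entries `≤ B` ⇒ `‖det A‖ ≤ (m B²)^{m/2}` for an `m = 2n`-matrix;
* `norm_gaussExpect_hubbardInteraction_pow_le` — `‖∫dμ_{C_M} Vⁿ‖ ≤ (|U| L² β (2n) B²)ⁿ`, uniformly in `M`;
* `hubbardMomentBound_le_geometric`, `summable_hubbardMomentBound` — `(n!)⁻¹(|U|L²β(2n)B²)ⁿ ≤ (2e|U|L²βB²)ⁿ`;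
* **`tendsto_effPartitionFn_hubbard_zero_seed`** — for `β > 0` and `2e|U|L²βB² < 1`,
  `∫dμ_{C_M} e^{-V} → Σ'_n ((−1)ⁿ/n!) Uⁿ Σ_{x⃗} ∫_{[0,β]ⁿ} det[vertexLimitEntry] dτ` as `M → ∞`, the limit series
  being absolutely convergent (`summable_hubbardLimitSeries`, `norm_hubbardLimitTerm_le`).

The identification of the limit with `Tr e^{-βH}/Tr e^{-βH₀}` (`ShiftedHubbardDysonDeterminant`, `ν = ½`) is NOT
here.

## Sources

G. Benfatto, A. Giuliani, V. Mastropietro, Ann. Henri Poincaré 7 (2006) 809–898 = arXiv:cond-mat/0507686, §2.1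
(2.6)–(2.8) [`BenfattoGiulianiMastropietro2006`]; J. Feldman, H. Knörrer, E. Trubowitz, *Fermionic Functional
Integrals and the Renormalization Group* (2002), §I.3 (Gram/Hadamard bounds for fermionic determinants)
[`FeldmanKnorrerTrubowitz2002`].
-/

noncomputable section

namespace Literature.MathematicalPhysics.QuantumLattice

open GrassmannAlgebra Finset Filter _root_.MeasureTheory Literature.Probability.LatticeModels _root_.Topology
open scoped Nat

/-! ### The finite exponential series of the normalised partition function -/

section Series

variable {Γ : Type*} [Fintype Γ]

/-- **The normalised partition function is a finite exponential series in the moments**: for `V` without constant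
part and any `N > |Γ|`, `∫dμ_C e^{-V} = Σ_{n<N} (−1)ⁿ/n! ∫dμ_C Vⁿ` (nilpotency `V^{|Γ|+1} = 0`).
[cite: BenfattoGiulianiMastropietro2006, §2.1 (2.6)] -/
theorem effPartitionFn_eq_sum_range (C : Matrix Γ Γ ℂ) {V : GrassmannAlgebra ℂ Γ} (hV0 : constPart ℂ V = 0)
    {N : ℕ} (hN : Fintype.card Γ + 1 ≤ N) :
    effPartitionFn ℂ C V = ∑ n ∈ Finset.range N, ((-1 : ℂ) ^ n * ((n ! : ℂ))⁻¹) * gaussExpect ℂ C (V ^ n) := by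
  have hnil : (-V) ^ N = 0 :=
    pow_eq_zero_of_le hN (pow_card_succ_eq_zero_of_constPart_eq_zero ℂ (by rw [map_neg, hV0, neg_zero]))
  rw [effPartitionFn_eq_gaussExpect, grassmannExp, IsNilpotent.exp_eq_sum hnil, map_sum]
  refine sum_congr rfl fun n _ => ?_
  rw [← Rat.cast_smul_eq_qsmul ℂ, map_smul, smul_eq_mul, ← neg_one_smul ℂ V, smul_pow, map_smul, smul_eq_mul,
    Rat.cast_inv, Rat.cast_natCast]
  ring

/-- The same as an infinite series (all terms of order `> |Γ|` vanish). [cite: BenfattoGiulianiMastropietro2006, §2.1 (2.6)] -/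
theorem effPartitionFn_eq_tsum (C : Matrix Γ Γ ℂ) {V : GrassmannAlgebra ℂ Γ} (hV0 : constPart ℂ V = 0) :
    effPartitionFn ℂ C V = ∑' n : ℕ, ((-1 : ℂ) ^ n * ((n ! : ℂ))⁻¹) * gaussExpect ℂ C (V ^ n) := by
  rw [effPartitionFn_eq_sum_range C hV0 le_rfl, tsum_eq_sum]
  intro n hn
  rw [Finset.mem_range, not_lt] at hn
  rw [pow_eq_zero_of_le hn (pow_card_succ_eq_zero_of_constPart_eq_zero ℂ hV0), map_zero, mul_zero]

/-- The moments of order `> |Γ|` vanish. [folklore] -/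
theorem gaussExpect_pow_eq_zero_of_card_lt (C : Matrix Γ Γ ℂ) {V : GrassmannAlgebra ℂ Γ}
    (hV0 : constPart ℂ V = 0) {n : ℕ} (hn : Fintype.card Γ + 1 ≤ n) : gaussExpect ℂ C (V ^ n) = 0 := by
  rw [pow_eq_zero_of_le hn (pow_card_succ_eq_zero_of_constPart_eq_zero ℂ hV0), map_zero]

end Series

/-! ### Hadamard's bound for the Wick determinants, uniformly in the cutoff -/

section Hadamard

/-- **Hadamard's inequality, entrywise form**: if all entries of an `m × m` complex matrix are bounded by `B ≥ 0`
then `‖det A‖ ≤ (m B²)^{m/2}`; stated for even size `m = n·2` as `‖det A‖ ≤ ((n·2) B²)ⁿ`.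
[cite: FeldmanKnorrerTrubowitz2002, §I.3] -/
theorem norm_det_le_of_entry_le {n : ℕ} (A : Matrix (Fin (n * 2)) (Fin (n * 2)) ℂ) {B : ℝ}
    (h : ∀ i j, ‖A i j‖ ≤ B) : ‖A.det‖ ≤ (((n * 2 : ℕ) : ℝ) * B ^ 2) ^ n := by
  have hsq := Literature.Analysis.Matrix.norm_det_sq_le_of_entry_le A (fun _ => B) h
  rw [Finset.prod_const, Finset.card_univ, Fintype.card_fin] at hsq
  have h2 : (((n * 2 : ℕ) : ℝ) * B ^ 2) ^ (n * 2) = ((((n * 2 : ℕ) : ℝ) * B ^ 2) ^ n) ^ 2 := by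
    rw [← pow_mul, mul_comm n 2]
  rw [h2] at hsq
  exact (pow_le_pow_iff_left₀ (norm_nonneg _) (by positivity) two_ne_zero).1 hsq

variable {L : ℕ} [NeZero L]

/-- The uniform entry bound `B = L⁻² Σ_{k⃗} (2 + β|ξ_{k⃗}|/3)` is at least `2`. [folklore] -/
theorem two_le_vertexEntryBound {β : ℝ} (hβ : 0 ≤ β) (μ : ℝ) :
    (2 : ℝ) ≤ (1 / (L : ℝ) ^ 2) * ∑ q : TorusSite 2 L, (2 + β * |nambuXi L μ q| / 3) := by
  have hL : (0 : ℝ) < (L : ℝ) ^ 2 := by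
    have : (0 : ℝ) < L := by exact_mod_cast Nat.pos_of_ne_zero (NeZero.ne L)
    positivity
  have hcard : ((Fintype.card (TorusSite 2 L) : ℕ) : ℝ) = (L : ℝ) ^ 2 := by
    rw [Fintype.card_pi, prod_const, ZMod.card, card_univ, Fintype.card_fin, Nat.cast_pow]
  have hsum : ∑ _q : TorusSite 2 L, (2 : ℝ) ≤ ∑ q : TorusSite 2 L, (2 + β * |nambuXi L μ q| / 3) :=
    sum_le_sum fun q _ => by
      have : 0 ≤ β * |nambuXi L μ q| / 3 := by positivity
      linarith
  rw [sum_const, card_univ, nsmul_eq_mul, hcard] at hsum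
  calc (2 : ℝ) = (1 / (L : ℝ) ^ 2) * ((L : ℝ) ^ 2 * 2) := by
        rw [← mul_assoc, one_div_mul_cancel hL.ne', one_mul]
    _ ≤ _ := by gcongr

/-- **The moments are bounded uniformly in the cutoff**: for `β > 0`,
`‖∫dμ_{C_M} Vⁿ‖ ≤ (|U| · L² · β · ((2n) B²))ⁿ`, `B = L⁻² Σ_{k⃗}(2 + β|ξ_{k⃗}|/3)` — `L²ⁿ` vertex positions, the time
cube of volume `βⁿ`, and Hadamard's bound for the `2n × 2n` Wick determinant of entries `≤ B`.
[cite: BenfattoGiulianiMastropietro2006, §2.1 (2.6)-(2.8)] -/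
theorem norm_gaussExpect_hubbardInteraction_pow_le {M : ℕ} {β : ℝ} (hβ : 0 < β) (μ U : ℝ) (n : ℕ) :
    ‖gaussExpect ℂ (hubbardCovariance L M β μ 0) (hubbardInteraction L M β U ^ n)‖ ≤
      (|U| * (L : ℝ) ^ 2 * β * ((((n * 2 : ℕ) : ℝ)) *
        ((1 / (L : ℝ) ^ 2) * ∑ q : TorusSite 2 L, (2 + β * |nambuXi L μ q| / 3)) ^ 2)) ^ n := by
  set B : ℝ := (1 / (L : ℝ) ^ 2) * ∑ q : TorusSite 2 L, (2 + β * |nambuXi L μ q| / 3) with hB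
  have hB0 : 0 ≤ B := le_trans (by norm_num) (two_le_vertexEntryBound (L := L) hβ.le μ)
  have hcard : ((Fintype.card (Fin n → TorusSite 2 L) : ℕ) : ℝ) = ((L : ℝ) ^ 2) ^ n := by
    rw [Fintype.card_fun, Fintype.card_fin, Nat.cast_pow, Fintype.card_pi, prod_const, ZMod.card, card_univ,
      Fintype.card_fin, Nat.cast_pow]
  have hvol : (volume : Measure (Fin n → ℝ)).real (Set.Icc (0 : Fin n → ℝ) fun _ => β) = β ^ n := by
    rw [measureReal_def, Real.volume_Icc_pi_toReal (a := 0) (b := fun _ => β) (fun _ => hβ.le)]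
    simp
  -- each cube integral of a Wick determinant is at most `((2n)B²)ⁿ βⁿ`
  have hdet : ∀ x : Fin n → TorusSite 2 L, ‖∫ τ in Set.Icc (0 : Fin n → ℝ) (fun _ => β),
      (Matrix.of fun i j : Fin (n * 2) => -((vertexSubMatrix L M β x τ).transpose * hubbardCovariance L M β μ 0 *
        vertexSubMatrix L M β x τ) ((((finProdFinEquiv.symm i : Fin n × Fin 2)), 0) : VertexLeg n)
          ((((finProdFinEquiv.symm j : Fin n × Fin 2)), 1) : VertexLeg n)).det‖ ≤
      (((n * 2 : ℕ) : ℝ) * B ^ 2) ^ n * β ^ n := by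
    intro x
    rw [← hvol]
    refine norm_setIntegral_le_of_norm_le_const (Literature.Analysis.Matrix.volume_Icc_cube_ne_top β).lt_top
      fun τ _ => norm_det_le_of_entry_le _ fun i j => ?_
    rw [Matrix.of_apply]
    exact norm_vertexWickEntry_le hβ μ x τ M _ _ _ _
  rw [gaussExpect_hubbardInteraction_pow_eq_det hβ, norm_mul, norm_pow, Complex.norm_real, Real.norm_eq_abs]
  calc |U| ^ n * ‖∑ x : Fin n → TorusSite 2 L, _‖
      ≤ |U| ^ n * ∑ x : Fin n → TorusSite 2 L, (((n * 2 : ℕ) : ℝ) * B ^ 2) ^ n * β ^ n := by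
        gcongr
        exact (norm_sum_le _ _).trans (sum_le_sum fun x _ => hdet x)
    _ = (|U| * (L : ℝ) ^ 2 * β * ((((n * 2 : ℕ) : ℝ)) * B ^ 2)) ^ n := by
        rw [sum_const, card_univ, nsmul_eq_mul, hcard]
        ring

end Hadamard

/-! ### The dominating geometric series -/

section Domination

/-- `nⁿ/n! ≤ eⁿ`. [folklore] -/
theorem pow_self_div_factorial_le_exp (n : ℕ) : (n : ℝ) ^ n / n ! ≤ Real.exp 1 ^ n := by
  rw [← Real.exp_nat_mul, mul_one]
  exact Real.pow_div_factorial_le_exp _ (Nat.cast_nonneg _) n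

/-- **The factorially weighted moment bound is dominated by a geometric sequence**:
`(n!)⁻¹ (a · (2n) · b)ⁿ ≤ (2e·a·b)ⁿ` for `a, b ≥ 0`. [folklore] -/
theorem inv_factorial_mul_pow_le_geometric {a b : ℝ} (ha : 0 ≤ a) (hb : 0 ≤ b) (n : ℕ) :
    ((n ! : ℝ))⁻¹ * (a * (((n * 2 : ℕ) : ℝ) * b)) ^ n ≤ (2 * Real.exp 1 * a * b) ^ n := by
  have hfac : (0 : ℝ) < n ! := by exact_mod_cast Nat.factorial_pos n
  have key := pow_self_div_factorial_le_exp n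
  rw [div_le_iff₀ hfac] at key
  calc ((n ! : ℝ))⁻¹ * (a * (((n * 2 : ℕ) : ℝ) * b)) ^ n
      = ((n ! : ℝ))⁻¹ * ((2 * a * b) ^ n * (n : ℝ) ^ n) := by
        rw [← mul_pow]
        congr 2
        push_cast
        ring
    _ ≤ ((n ! : ℝ))⁻¹ * ((2 * a * b) ^ n * (Real.exp 1 ^ n * n !)) := by
        gcongr
    _ = (2 * a * b) ^ n * Real.exp 1 ^ n := by
        field_simp
    _ = (2 * Real.exp 1 * a * b) ^ n := by
        rw [← mul_pow]
        congr 1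
        ring

end Domination

/-! ### The limit of the normalised partition functions -/

section Limit

variable {L : ℕ} [NeZero L]

/-- **The `M → ∞` limit of the normalised Grassmann partition function of the Hubbard torus is the determinant
series** (zero seed): for `β > 0` and `2e · |U| · L² · β · B² < 1` (`B = L⁻² Σ_{k⃗}(2 + β|ξ_{k⃗}|/3)`),
`∫dμ_{C_M} e^{-V} ⟶ Σ'_n ((−1)ⁿ/n!) · Uⁿ Σ_{x⃗ ∈ Λⁿ} ∫_{[0,β]ⁿ} det[vertexLimitEntry(x⃗_{aᵢ},x⃗_{aⱼ},σᵢ,σⱼ; τ_{aⱼ}−τ_{aᵢ})] dτ`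
as `M → ∞` — the finite exponential series (`effPartitionFn_eq_tsum`), the per-order limits
(`tendsto_gaussExpect_hubbardInteraction_pow`) and Tannery's theorem with the Hadamard domination
`(n!)⁻¹(|U|L²β(2n)B²)ⁿ ≤ (2e|U|L²βB²)ⁿ`. [cite: BenfattoGiulianiMastropietro2006, §2.1 (2.6)-(2.8)] -/
theorem tendsto_effPartitionFn_hubbard_zero_seed {β : ℝ} (hβ : 0 < β) (μ : ℝ) {U : ℝ}
    (hU : 2 * Real.exp 1 * (|U| * (L : ℝ) ^ 2 * β) *
      ((1 / (L : ℝ) ^ 2) * ∑ q : TorusSite 2 L, (2 + β * |nambuXi L μ q| / 3)) ^ 2 < 1) :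
    Tendsto (fun M : ℕ => effPartitionFn ℂ (hubbardCovariance L M β μ 0) (hubbardInteraction L M β U)) atTop
      (𝓝 (∑' n : ℕ, ((-1 : ℂ) ^ n * ((n ! : ℂ))⁻¹) * ((U : ℂ) ^ n * ∑ x : Fin n → TorusSite 2 L,
        ∫ τ in Set.Icc (0 : Fin n → ℝ) (fun _ => β),
          (Matrix.of fun i j : Fin (n * 2) =>
            vertexLimitEntry L β μ (x (finProdFinEquiv.symm i : Fin n × Fin 2).1)
              (x (finProdFinEquiv.symm j : Fin n × Fin 2).1) (finProdFinEquiv.symm i : Fin n × Fin 2).2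
              (finProdFinEquiv.symm j : Fin n × Fin 2).2
              (τ (finProdFinEquiv.symm j : Fin n × Fin 2).1 - τ (finProdFinEquiv.symm i : Fin n × Fin 2).1)).det))) := by
  set B : ℝ := (1 / (L : ℝ) ^ 2) * ∑ q : TorusSite 2 L, (2 + β * |nambuXi L μ q| / 3) with hB
  have hB0 : 0 ≤ B := le_trans (by norm_num) (two_le_vertexEntryBound (L := L) hβ.le μ)
  set a : ℝ := |U| * (L : ℝ) ^ 2 * β with ha
  have ha0 : 0 ≤ a := by positivity
  set r : ℝ := 2 * Real.exp 1 * a * B ^ 2 with hr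
  have hr0 : 0 ≤ r := by positivity
  have hr1 : r < 1 := by rw [hr, ha]; exact hU
  -- the finite-`M` partition functions as series
  have hZ : ∀ M : ℕ, effPartitionFn ℂ (hubbardCovariance L M β μ 0) (hubbardInteraction L M β U) =
      ∑' n : ℕ, ((-1 : ℂ) ^ n * ((n ! : ℂ))⁻¹) *
        gaussExpect ℂ (hubbardCovariance L M β μ 0) (hubbardInteraction L M β U ^ n) := fun M =>
    effPartitionFn_eq_tsum _ (constPart_hubbardInteraction L M β U)
  simp_rw [hZ]
  refine tendsto_tsum_of_dominated_convergence (bound := fun n => r ^ n) ?_ (fun n => ?_) ?_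
  · exact summable_geometric_of_lt_one hr0 hr1
  · exact (tendsto_gaussExpect_hubbardInteraction_pow hβ μ U n).const_mul _
  · refine Eventually.of_forall fun M n => ?_
    rw [norm_mul, norm_mul, norm_pow, norm_neg, norm_one, one_pow, one_mul, norm_inv, Complex.norm_natCast]
    calc ((n ! : ℝ))⁻¹ * ‖gaussExpect ℂ (hubbardCovariance L M β μ 0) (hubbardInteraction L M β U ^ n)‖
        ≤ ((n ! : ℝ))⁻¹ * (a * (((n * 2 : ℕ) : ℝ) * B ^ 2)) ^ n := by
          gcongr
          rw [ha, hB]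
          exact norm_gaussExpect_hubbardInteraction_pow_le hβ μ U n
      _ ≤ r ^ n := inv_factorial_mul_pow_le_geometric ha0 (by positivity) n

/-- Under the same smallness condition the moments obey `(n!)⁻¹‖∫dμ_{C_M} Vⁿ‖ ≤ (2e|U|L²βB²)ⁿ` for every `M`, so
the finite-`M` series are dominated by ONE convergent geometric series. [cite: BenfattoGiulianiMastropietro2006, §2.1 (2.8)] -/
theorem inv_factorial_mul_norm_gaussExpect_pow_le {M : ℕ} {β : ℝ} (hβ : 0 < β) (μ U : ℝ) (n : ℕ) :
    ((n ! : ℝ))⁻¹ * ‖gaussExpect ℂ (hubbardCovariance L M β μ 0) (hubbardInteraction L M β U ^ n)‖ ≤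
      (2 * Real.exp 1 * (|U| * (L : ℝ) ^ 2 * β) *
        ((1 / (L : ℝ) ^ 2) * ∑ q : TorusSite 2 L, (2 + β * |nambuXi L μ q| / 3)) ^ 2) ^ n := by
  have hB0 : 0 ≤ (1 / (L : ℝ) ^ 2) * ∑ q : TorusSite 2 L, (2 + β * |nambuXi L μ q| / 3) :=
    le_trans (by norm_num) (two_le_vertexEntryBound (L := L) hβ.le μ)
  calc ((n ! : ℝ))⁻¹ * ‖gaussExpect ℂ (hubbardCovariance L M β μ 0) (hubbardInteraction L M β U ^ n)‖
      ≤ ((n ! : ℝ))⁻¹ * ((|U| * (L : ℝ) ^ 2 * β) * (((n * 2 : ℕ) : ℝ) *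
          ((1 / (L : ℝ) ^ 2) * ∑ q : TorusSite 2 L, (2 + β * |nambuXi L μ q| / 3)) ^ 2)) ^ n := by
        gcongr
        exact norm_gaussExpect_hubbardInteraction_pow_le hβ μ U n
    _ ≤ _ := inv_factorial_mul_pow_le_geometric (by positivity) (by positivity) n

/-- **The limit series is absolutely convergent**: its `n`-th term is bounded by `(2e|U|L²βB²)ⁿ` (limit of the
uniform finite-`M` bounds). [cite: BenfattoGiulianiMastropietro2006, §2.1 (2.8)] -/
theorem norm_hubbardLimitTerm_le {β : ℝ} (hβ : 0 < β) (μ U : ℝ) (n : ℕ) :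
    ‖((-1 : ℂ) ^ n * ((n ! : ℂ))⁻¹) * ((U : ℂ) ^ n * ∑ x : Fin n → TorusSite 2 L,
        ∫ τ in Set.Icc (0 : Fin n → ℝ) (fun _ => β),
          (Matrix.of fun i j : Fin (n * 2) =>
            vertexLimitEntry L β μ (x (finProdFinEquiv.symm i : Fin n × Fin 2).1)
              (x (finProdFinEquiv.symm j : Fin n × Fin 2).1) (finProdFinEquiv.symm i : Fin n × Fin 2).2
              (finProdFinEquiv.symm j : Fin n × Fin 2).2
              (τ (finProdFinEquiv.symm j : Fin n × Fin 2).1 - τ (finProdFinEquiv.symm i : Fin n × Fin 2).1)).det)‖ ≤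
      (2 * Real.exp 1 * (|U| * (L : ℝ) ^ 2 * β) *
        ((1 / (L : ℝ) ^ 2) * ∑ q : TorusSite 2 L, (2 + β * |nambuXi L μ q| / 3)) ^ 2) ^ n := by
  have hlim := ((tendsto_gaussExpect_hubbardInteraction_pow (L := L) hβ μ U n).const_mul
    ((-1 : ℂ) ^ n * ((n ! : ℂ))⁻¹)).norm
  refine le_of_tendsto' hlim fun M => ?_
  rw [norm_mul, norm_mul, norm_pow, norm_neg, norm_one, one_pow, one_mul, norm_inv, Complex.norm_natCast]
  exact inv_factorial_mul_norm_gaussExpect_pow_le hβ μ U n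

/-- Hence the limit series is summable when `2e|U|L²βB² < 1`. [cite: BenfattoGiulianiMastropietro2006, §2.1 (2.8)] -/
theorem summable_hubbardLimitSeries {β : ℝ} (hβ : 0 < β) (μ : ℝ) {U : ℝ}
    (hU : 2 * Real.exp 1 * (|U| * (L : ℝ) ^ 2 * β) *
      ((1 / (L : ℝ) ^ 2) * ∑ q : TorusSite 2 L, (2 + β * |nambuXi L μ q| / 3)) ^ 2 < 1) :
    Summable fun n : ℕ => ((-1 : ℂ) ^ n * ((n ! : ℂ))⁻¹) * ((U : ℂ) ^ n * ∑ x : Fin n → TorusSite 2 L,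
        ∫ τ in Set.Icc (0 : Fin n → ℝ) (fun _ => β),
          (Matrix.of fun i j : Fin (n * 2) =>
            vertexLimitEntry L β μ (x (finProdFinEquiv.symm i : Fin n × Fin 2).1)
              (x (finProdFinEquiv.symm j : Fin n × Fin 2).1) (finProdFinEquiv.symm i : Fin n × Fin 2).2
              (finProdFinEquiv.symm j : Fin n × Fin 2).2
              (τ (finProdFinEquiv.symm j : Fin n × Fin 2).1 - τ (finProdFinEquiv.symm i : Fin n × Fin 2).1)).det) := by
  have hB0 : 0 ≤ (1 / (L : ℝ) ^ 2) * ∑ q : TorusSite 2 L, (2 + β * |nambuXi L μ q| / 3) :=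
    le_trans (by norm_num) (two_le_vertexEntryBound (L := L) hβ.le μ)
  have hr0 : 0 ≤ 2 * Real.exp 1 * (|U| * (L : ℝ) ^ 2 * β) *
      ((1 / (L : ℝ) ^ 2) * ∑ q : TorusSite 2 L, (2 + β * |nambuXi L μ q| / 3)) ^ 2 := by positivity
  exact Summable.of_norm_bounded (summable_geometric_of_lt_one hr0 hU) fun n => norm_hubbardLimitTerm_le hβ μ U n

end Limit

end Literature.MathematicalPhysics.QuantumLattice
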